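import Summits.HubbardSuperconductivity.HubbardSuperconductivity.Theorems.AnisotropyChordTransferFibre3N1RowCellSound

/-!
# Route `AnisotropyChord` / H0 rotor rung, LEVEL 2 row `N₁`: the `ν`-column `[20077, 20880]/10⁶` — named-sum brackets

The `ν`-cell `ν = λ₂/θ² ∈ [0.020077, 0.02088]` of the ∀L ≥ 128 kernel certificate of the (KT-1″) trial-gap bound: the twelve
L-uniform named-sum brackets (`colN20077` : `L2.NamedCell`, `T = 241/10⁵ ≥ θ₀²`, rounding denominator `10⁶`) and their kernel
certificate ★ `colN20077_check : colN20077.check = true` (integer B1 evaluator of p2 g4, one `decide`, ≈ 2 min); shared by all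
`a`-cells of this column (files `…N1RowL2N20077A….lean`).  Generated by p2 g5's cells/mkfiles.py (HOME/hubbard-h0-rotor-p2/cells/).
Prover seat `hubbard-h0-rotor-p2` g5; helper for piece A = stmt-HubbardSuperconductivity-23918 of rung 19089
(`--supports`, helper class).  Nothing here proves superconductivity in the Hubbard model; one kernel-certified piece of ONE
conditional reduction (the GM₃ ∀L certificate, Level-2 row `N₁`); the rotor TARGET as originally worded stays FALSE (g15 verdict).
Mathlib + the tree only; no sorry.
-/

set_option linter.dupNamespace false
set_option autoImplicit false

open Literature.Analysis.ValidatedNumerics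

namespace Summit.HubbardSuperconductivity.HubbardSuperconductivity.Theorems.AnisotropyChord.Transfer.Fibre3.L2.N1

/-- the column data: `ν`-cell `[20077, 20880]/10⁶` and the twelve certified brackets of
`θ⁴S₂, θ⁶S₃, θ⁸S₄, θ⁴T10, θ⁴T11, θ⁶G21, θ⁶G12, θ⁸G22, θ⁸G31, θ⁸G13, θ⁴Tx(1,0), θ⁴Tx(1,1)`. -/
def colN20077 : L2.NamedCell :=
  { n1 := 20077,
    n2 := 20880,
    νd := 1000000,
    Tn := 241,
    Td := 100000,
    D := 1000000,
    bS2 := (62147/10000, 3126825559/500000000),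
    bS3 := (307927/62500, 197826653/40000000),
    bS4 := (231511/50000, 18175891/3906250),
    bT10 := (236851/62500, 3826008833/1000000000),
    bT11 := (527327/125000, 4256638833/1000000000),
    bG21 := (2148303/1000000, 2158203571/1000000000),
    bG12 := (2148303/1000000, 2158203571/1000000000),
    bG22 := (313199/250000, 1261174141/1000000000),
    bG31 := (1698759/1000000, 1709033141/1000000000),
    bG13 := (1698759/1000000, 1709033141/1000000000),
    bTx10 := (3754907167/1000000000, 3826008833/1000000000),
    bTx11 := (4184173167/1000000000, 4256638833/1000000000) }

/-- ★ the named-sum brackets of the column hold (kernel evaluation of the integer B1 certificate). -/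
theorem colN20077_check : colN20077.check = true := by decide +kernel

end Summit.HubbardSuperconductivity.HubbardSuperconductivity.Theorems.AnisotropyChord.Transfer.Fibre3.L2.N1
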